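import Summits.QuantumAdvantage.AdviceFreeQNC0.UCoord39B
import HarnessLib

/-!
# Cell qa-qnc0, `p = 3` — the TWO-CHARACTER junta blindness lemma (planner qa-qnc0-p1 g39, ROUND-38 §2 CAVEAT "the RELATIVE residue",
# ask A39-2 "left to the porter"; prover qn-prover-3 g26)

Lemma B′ (`UCoord39.juntaBlindness`, tree) makes the walk position `W_k` blind to a junta: `‖Σ_x ω^{a·W_k(x)} f(x)‖ ≤ 4·2^N/2^{k − 2 s'}`.
Liveness of bell `k` involves the GLOBAL trit `W = W_N` as well; after resolving the odd class / `W`-sector by characters the relevant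
sums are `Σ_x ω^{a·W_k(x) + a'·W(x)} f(x)` (ROUND-38 §2, CAVEAT): in u-coordinates the coordinates `j < k` carry `ω^{(a+a')u_j}`, the
coordinates `j ≥ k` carry `ω^{a' u_j}`, and the same Fubini over the CLEAN u-coordinates (those `j ∉ T`, `j + 1 ∉ T`) gives
`≤ 2^N / 2^{#{clean j : c_j ≠ 0}}`, `c_j = a·[j<k] + a'` — "the same proof with a coordinate-dependent phase, left to the porter".

* `UCoord39.pow_mul_sum_prod_coord_dep`, `norm_sum_prod_coord_dep_le` — the Fubini identity / bound of `UCoord39` with a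
  COORDINATE-DEPENDENT one-coordinate factor `φ_j`;
* **`UCoord39.phaseJuntaBlindness`** — for every coefficient vector `c : Fin N → 𝔽₃` and every bounded `T`-junta `f`:
  `‖Σ_x ω^{Σ_j c_j·u_j(x)} f(x)‖ ≤ 2^N / 2^{#{j : Clean N (indVec T) j ∧ c_j ≠ 0}}`;
* **`UCoord39.twoCharJuntaBlindness`** — `‖Σ_x ω^{a·W_k(x) + a'·W_N(x)} f(x)‖ ≤ 2^N / 2^{#{j T-clean : (j < k ? a + a' : a') ≠ 0}}`, and the
  two one-sided readings `twoCharJuntaBlindness_prefix` (`a + a' ≠ 0`: `≤ 4·2^N/2^{k − 2#{i<k : i ∈ T}}`, the knowing zone is a PREFIX) and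
  `twoCharJuntaBlindness_suffix` (`a' ≠ 0`: exponent = number of `T`-clean coordinates `≥ k`, the knowing zone is a SUFFIX).

WHAT THIS IS NOT: no statement about the game; crux `stmt-QuantumAdvantage-22907` untouched.
-/

namespace Summit.QuantumAdvantage.AdviceFreeQNC0.UCoord39

open Finset Summit.QuantumAdvantage.AdviceFreeQNC0 Literature.Computability.MetaComplexity

variable {N : ℕ}

/-! ## Fubini over blind coordinates with coordinate-dependent factors -/

/-- If `G` is blind to every coordinate in `C` then `2^{#C}·Σ_u (∏_{i∈C} φ_i(u_i))·G(u) = (∏_{i∈C}(φ_i tt + φ_i ff))·Σ_u G(u)`. -/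
theorem pow_mul_sum_prod_coord_dep (C : Finset (Fin N)) (φ : Fin N → Bool → ℂ) :
    ∀ G : (Fin N → Bool) → ℂ, (∀ (u : Fin N → Bool) (j : Fin N) (b : Bool), j ∈ C → G (Function.update u j b) = G u) →
      (2 : ℂ) ^ C.card * ∑ u : Fin N → Bool, (∏ i ∈ C, φ i (u i)) * G u
        = (∏ i ∈ C, (φ i true + φ i false)) * ∑ u : Fin N → Bool, G u := by
  classical
  induction C using Finset.induction_on with
  | empty =>
    intro G _
    simp
  | @insert j C hj ih =>
    intro G hG
    rw [Finset.card_insert_of_notMem hj, Finset.prod_insert hj]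
    have hprod : ∀ u : Fin N → Bool, (∏ i ∈ insert j C, φ i (u i)) * G u = (∏ i ∈ C, φ i (u i)) * (φ j (u j) * G u) := by
      intro u
      rw [Finset.prod_insert hj, mul_assoc, mul_left_comm]
    rw [Fintype.sum_congr _ _ hprod]
    have hG' : ∀ (u : Fin N → Bool) (i : Fin N) (b : Bool), i ∈ C →
        φ j ((Function.update u i b) j) * G (Function.update u i b) = φ j (u j) * G u := by
      intro u i b hi
      have hne : j ≠ i := fun h => hj (h ▸ hi)
      rw [Function.update_of_ne hne, hG u i b (Finset.mem_insert_of_mem hi)]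
    have h1 := ih (fun u => φ j (u j) * G u) hG'
    have h2 := two_mul_sum_coord j (φ j) G (fun u b => hG u j b (Finset.mem_insert_self j C))
    rw [pow_succ, mul_comm ((2 : ℂ) ^ C.card) 2, mul_assoc, h1, ← mul_assoc, mul_comm (2 : ℂ), mul_assoc, h2, ← mul_assoc,
      mul_comm (∏ i ∈ C, (φ i true + φ i false))]

/-- Norm form: `‖Σ_u (∏_{i∈C} φ_i(u_i))·G(u)‖ ≤ (∏_{i∈C} ‖φ_i tt + φ_i ff‖) · 2^N / 2^{#C}` when `‖G‖ ≤ 1`. -/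
theorem norm_sum_prod_coord_dep_le (C : Finset (Fin N)) (φ : Fin N → Bool → ℂ) (G : (Fin N → Bool) → ℂ)
    (hG : ∀ (u : Fin N → Bool) (j : Fin N) (b : Bool), j ∈ C → G (Function.update u j b) = G u)
    (hG1 : ∀ u, ‖G u‖ ≤ 1) :
    ‖∑ u : Fin N → Bool, (∏ i ∈ C, φ i (u i)) * G u‖
      ≤ (∏ i ∈ C, ‖φ i true + φ i false‖) * (2 : ℝ) ^ N / (2 : ℝ) ^ C.card := by
  have h := pow_mul_sum_prod_coord_dep C φ G hG
  have h2pos : (0 : ℝ) < (2 : ℝ) ^ C.card := by positivity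
  rw [le_div_iff₀ h2pos]
  have hn : ‖(2 : ℂ) ^ C.card * ∑ u : Fin N → Bool, (∏ i ∈ C, φ i (u i)) * G u‖
      = ‖∑ u : Fin N → Bool, (∏ i ∈ C, φ i (u i)) * G u‖ * (2 : ℝ) ^ C.card := by
    rw [norm_mul, norm_pow, Complex.norm_ofNat, mul_comm]
  rw [← hn, h, norm_mul, norm_prod]
  have hsum : ‖∑ u : Fin N → Bool, G u‖ ≤ (2 : ℝ) ^ N := by
    calc ‖∑ u : Fin N → Bool, G u‖ ≤ ∑ u : Fin N → Bool, ‖G u‖ := norm_sum_le _ _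
      _ ≤ ∑ _u : Fin N → Bool, (1 : ℝ) := Finset.sum_le_sum fun u _ => hG1 u
      _ = (2 : ℝ) ^ N := by simp
  exact mul_le_mul_of_nonneg_left hsum (prod_nonneg fun i _ => norm_nonneg _)

/-! ## Blindness of an arbitrary u-linear phase to a junta -/

/-- **Phase–junta blindness.**  For every coefficient vector `c` and every `T`-junta `f` with `‖f‖ ≤ 1`:
`‖Σ_x ω^{Σ_j [u_j(x)]·c_j} f(x)‖ ≤ 2^N / 2^{#{j : Clean N (indVec T) j ∧ c_j ≠ 0}}` (sum out the `T`-clean u-coordinates with `c_j ≠ 0`: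
each gives `‖1 + ω^{c_j}‖/2 ≤ 1/2`). -/
theorem phaseJuntaBlindness (c : Fin N → ZMod 3) (T : Finset (Fin N)) (f : (Fin N → Bool) → ℂ)
    (hf : ∀ x x' : Fin N → Bool, (∀ i ∈ T, x i = x' i) → f x = f x') (hf1 : ∀ x, ‖f x‖ ≤ 1) :
    ‖∑ x : Fin N → Bool, (ZMod.stdAddChar (∑ j : Fin N, if uCoord x j then c j else 0) : ℂ) * f x‖
      ≤ (2 : ℝ) ^ N / (2 : ℝ) ^ (univ.filter fun j : Fin N => Clean N (indVec T) j ∧ c j ≠ 0).card := by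
  classical
  set C := univ.filter (fun j : Fin N => Clean N (indVec T) j ∧ c j ≠ 0) with hC
  set φ : Fin N → Bool → ℂ := fun j b => if b then (ZMod.stdAddChar (c j) : ℂ) else 1 with hφ
  set cO : Fin N → ZMod 3 := fun j => if j ∈ C then 0 else c j with hcO
  set G : (Fin N → Bool) → ℂ := fun u => (ZMod.stdAddChar (∑ j : Fin N, if u j then cO j else 0) : ℂ) * f (xOfU u) with hGdef
  rw [sum_eq_sum_xOfU]
  -- rewrite the summand in u-coordinates: clean phase factors × the rest
  have hF : ∀ u : Fin N → Bool,
      (ZMod.stdAddChar (∑ j : Fin N, if uCoord (xOfU u) j then c j else 0) : ℂ) * f (xOfU u)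
        = (∏ i ∈ C, φ i (u i)) * G u := by
    intro u
    rw [uCoord_xOfU]
    have hsplit : (∑ j : Fin N, if u j then c j else 0)
        = (∑ j : Fin N, if u j then (if j ∈ C then c j else 0) else 0) + (∑ j : Fin N, if u j then cO j else 0) := by
      rw [← sum_add_distrib]
      refine sum_congr rfl fun j _ => ?_
      by_cases hj : j ∈ C <;> cases u j <;> simp [hcO, hj]
    rw [hsplit, AddChar.map_add_eq_mul, TwoModuli.stdAddChar_sum_ite, mul_assoc]
    congr 1
    rw [← Finset.prod_filter_mul_prod_filter_not univ (fun j => j ∈ C)]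
    have h1 : ∏ j ∈ univ.filter (fun j => j ∉ C), (if u j then (ZMod.stdAddChar (if j ∈ C then c j else 0) : ℂ) else 1) = 1 :=
      prod_eq_one fun j hj => by
        have hjC : j ∉ C := (mem_filter.mp hj).2
        cases u j <;> simp [hjC]
    rw [h1, mul_one]
    have h2 : univ.filter (fun j => j ∈ C) = C := by ext j; simp
    rw [h2]
    refine prod_congr rfl fun j hj => ?_
    simp [hφ, hj]
  rw [Fintype.sum_congr _ _ hF]
  have hGinv : ∀ (u : Fin N → Bool) (j : Fin N) (b : Bool), j ∈ C → G (Function.update u j b) = G u := by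
    intro u j b hj
    have hjc : Clean N (indVec T) j := (mem_filter.mp hj).2.1
    have hsum : (∑ i : Fin N, if Function.update u j b i then cO i else 0) = ∑ i : Fin N, if u i then cO i else 0 := by
      refine sum_congr rfl fun i _ => ?_
      by_cases hij : i = j
      · subst hij
        have h0 : cO i = 0 := by simp [hcO, hj]
        simp [h0]
      · rw [Function.update_of_ne hij]
    simp only [hGdef]
    rw [hsum, hf _ _ (xOfU_update_eq_on T N u j hjc b)]
  have hG1 : ∀ u, ‖G u‖ ≤ 1 := fun u => by
    simp only [hGdef]; rw [norm_mul, AffBells21.norm_stdAddChar_three, one_mul]; exact hf1 _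
  refine (norm_sum_prod_coord_dep_le C φ G hGinv hG1).trans ?_
  have hφ1 : ∏ i ∈ C, ‖φ i true + φ i false‖ ≤ 1 := by
    refine prod_le_one (fun i _ => norm_nonneg _) fun i hi => ?_
    have hci : c i ≠ 0 := (mem_filter.mp hi).2.2
    simp only [hφ, if_true, Bool.false_eq_true, if_false, add_comm]
    have h := TwoModuli.norm_one_add_stdAddChar_le (p := 3) hci
    have hcos : Real.cos (Real.pi / ((3 : ℕ) : ℝ)) = 1 / 2 := by
      rw [show ((3 : ℕ) : ℝ) = 3 by norm_num, Real.cos_pi_div_three]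
    rw [hcos] at h
    linarith
  have hnn : (0 : ℝ) ≤ (2 : ℝ) ^ N / (2 : ℝ) ^ C.card := by positivity
  calc (∏ i ∈ C, ‖φ i true + φ i false‖) * (2 : ℝ) ^ N / (2 : ℝ) ^ C.card
      = (∏ i ∈ C, ‖φ i true + φ i false‖) * ((2 : ℝ) ^ N / (2 : ℝ) ^ C.card) := by ring
    _ ≤ 1 * ((2 : ℝ) ^ N / (2 : ℝ) ^ C.card) := mul_le_mul_of_nonneg_right hφ1 hnn
    _ = (2 : ℝ) ^ N / (2 : ℝ) ^ C.card := one_mul _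

/-! ## The two-character form -/

/-- The two-character phase in u-coordinates: `a·W_k + a'·W_N = Σ_j [u_j]·(a·[j<k] + a')`. -/
theorem twoChar_phase_eq (x : Fin N → Bool) (k : ℕ) (a a' : ZMod 3) :
    a * ((Wk x k : ℕ) : ZMod 3) + a' * ((Wk x N : ℕ) : ZMod 3)
      = ∑ j : Fin N, if uCoord x j then ((if j.val < k then a else 0) + a') else 0 := by
  unfold Wk
  rw [Finset.card_filter, Finset.card_filter, Nat.cast_sum, Nat.cast_sum, mul_sum, mul_sum, ← sum_add_distrib]
  refine sum_congr rfl fun j _ => ?_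
  have hjN : j.val < N := j.isLt
  by_cases hjk : j.val < k <;> cases uCoord x j <;> simp [hjk, hjN]

/-- **TWO-CHARACTER JUNTA BLINDNESS** (ROUND-38 §2 CAVEAT, ask A39-2).  For a `T`-junta `f` with `‖f‖ ≤ 1`, `a, a' ∈ 𝔽₃`, `k ≤ N`:
`‖Σ_x ω^{a·W_k(x) + a'·W_N(x)} f(x)‖ ≤ 2^N / 2^{#{j : Clean N (indVec T) j ∧ (a·[j<k] + a') ≠ 0}}`. -/
theorem twoCharJuntaBlindness (k : ℕ) (T : Finset (Fin N)) (f : (Fin N → Bool) → ℂ)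
    (hf : ∀ x x' : Fin N → Bool, (∀ i ∈ T, x i = x' i) → f x = f x') (hf1 : ∀ x, ‖f x‖ ≤ 1) (a a' : ZMod 3) :
    ‖∑ x : Fin N → Bool, (ZMod.stdAddChar (a * ((Wk x k : ℕ) : ZMod 3) + a' * ((Wk x N : ℕ) : ZMod 3)) : ℂ) * f x‖
      ≤ (2 : ℝ) ^ N / (2 : ℝ) ^ (univ.filter fun j : Fin N =>
          Clean N (indVec T) j ∧ ((if j.val < k then a else 0) + a') ≠ 0).card := by
  have h := phaseJuntaBlindness (fun j : Fin N => (if j.val < k then a else 0) + a') T f hf hf1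
  have e : ∀ x : Fin N → Bool, (ZMod.stdAddChar (a * ((Wk x k : ℕ) : ZMod 3) + a' * ((Wk x N : ℕ) : ZMod 3)) : ℂ)
      = (ZMod.stdAddChar (∑ j : Fin N, if uCoord x j then ((if j.val < k then a else 0) + a') else 0) : ℂ) := by
    intro x; rw [twoChar_phase_eq]
  simp_rw [e]
  exact h

/-- **Prefix reading** (`a + a' ≠ 0`): the clean coordinates below `k` all count, so
`‖Σ_x ω^{a·W_k + a'·W_N} f‖ ≤ 4·2^N / 2^{k − 2#{i < k : i ∈ T}}` — the knowing zone is a prefix, as in Lemma B′. -/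
theorem twoCharJuntaBlindness_prefix (k : ℕ) (hk : k ≤ N) (T : Finset (Fin N)) (f : (Fin N → Bool) → ℂ)
    (hf : ∀ x x' : Fin N → Bool, (∀ i ∈ T, x i = x' i) → f x = f x') (hf1 : ∀ x, ‖f x‖ ≤ 1) (a a' : ZMod 3)
    (haa : a + a' ≠ 0) :
    ‖∑ x : Fin N → Bool, (ZMod.stdAddChar (a * ((Wk x k : ℕ) : ZMod 3) + a' * ((Wk x N : ℕ) : ZMod 3)) : ℂ) * f x‖
      ≤ 4 * (2 : ℝ) ^ N / (2 : ℝ) ^ (k - 2 * (univ.filter fun i : Fin N => i.val < k ∧ i ∈ T).card) := by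
  classical
  refine (twoCharJuntaBlindness k T f hf hf1 a a').trans ?_
  -- the clean coordinates below `k` are among the counted ones
  have hsub : univ.filter (Clean k (indVec T)) ⊆
      univ.filter (fun j : Fin N => Clean N (indVec T) j ∧ ((if j.val < k then a else 0) + a') ≠ 0) := by
    intro j hj
    have hc : Clean k (indVec T) j := (mem_filter.mp hj).2
    refine mem_filter.mpr ⟨mem_univ _, ⟨j.isLt, hc.2.1, hc.2.2⟩, ?_⟩
    rw [if_pos hc.1]; exact haa
  have hcard := card_le_card hsub
  have hcount := sub_le_card_clean (indVec T) k hk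
  have hset : (univ.filter fun i : Fin N => i.val < k ∧ indVec T i ≠ 0) = (univ.filter fun i : Fin N => i.val < k ∧ i ∈ T) := by
    ext i; simp only [mem_filter, mem_univ, true_and, indVec_ne_zero_iff]
  rw [hset] at hcount
  set m := (univ.filter fun j : Fin N => Clean N (indVec T) j ∧ ((if j.val < k then a else 0) + a') ≠ 0).card with hm
  set s' := (univ.filter fun i : Fin N => i.val < k ∧ i ∈ T).card with hs'
  have hA : (0 : ℝ) < (2 : ℝ) ^ m := by positivity
  have hB : (0 : ℝ) < (2 : ℝ) ^ (k - 2 * s') := by positivity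
  rw [div_le_div_iff₀ hA hB]
  have hp : (2 : ℝ) ^ (k - 2 * s') ≤ (2 : ℝ) ^ (m + 2) := pow_le_pow_right₀ (by norm_num) (by omega)
  have h2N : (0 : ℝ) ≤ (2 : ℝ) ^ N := by positivity
  calc (2 : ℝ) ^ N * (2 : ℝ) ^ (k - 2 * s') ≤ (2 : ℝ) ^ N * (2 : ℝ) ^ (m + 2) := mul_le_mul_of_nonneg_left hp h2N
    _ = 4 * (2 : ℝ) ^ N * (2 : ℝ) ^ m := by ring

/-- **Suffix reading** (`a' ≠ 0`): the clean coordinates at or above `k` all count: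
`‖Σ_x ω^{a·W_k + a'·W_N} f‖ ≤ 2^N / 2^{#{j ≥ k : Clean N (indVec T) j}}` — for the relative residue `W − W_k` a bell is blind through the
letters AFTER it; the knowing zone is a SUFFIX (ROUND-38 §2 CAVEAT). -/
theorem twoCharJuntaBlindness_suffix (k : ℕ) (T : Finset (Fin N)) (f : (Fin N → Bool) → ℂ)
    (hf : ∀ x x' : Fin N → Bool, (∀ i ∈ T, x i = x' i) → f x = f x') (hf1 : ∀ x, ‖f x‖ ≤ 1) (a a' : ZMod 3)
    (ha' : a' ≠ 0) :
    ‖∑ x : Fin N → Bool, (ZMod.stdAddChar (a * ((Wk x k : ℕ) : ZMod 3) + a' * ((Wk x N : ℕ) : ZMod 3)) : ℂ) * f x‖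
      ≤ (2 : ℝ) ^ N / (2 : ℝ) ^ (univ.filter fun j : Fin N => k ≤ j.val ∧ Clean N (indVec T) j).card := by
  classical
  refine (twoCharJuntaBlindness k T f hf hf1 a a').trans ?_
  have hsub : univ.filter (fun j : Fin N => k ≤ j.val ∧ Clean N (indVec T) j) ⊆
      univ.filter (fun j : Fin N => Clean N (indVec T) j ∧ ((if j.val < k then a else 0) + a') ≠ 0) := by
    intro j hj
    obtain ⟨hjk, hc⟩ := (mem_filter.mp hj).2
    refine mem_filter.mpr ⟨mem_univ _, hc, ?_⟩
    rw [if_neg (by omega), zero_add]; exact ha'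
  have hcard := card_le_card hsub
  have hA : (0 : ℝ) < (2 : ℝ) ^ (univ.filter fun j : Fin N =>
      Clean N (indVec T) j ∧ ((if j.val < k then a else 0) + a') ≠ 0).card := by positivity
  have hB : (0 : ℝ) < (2 : ℝ) ^ (univ.filter fun j : Fin N => k ≤ j.val ∧ Clean N (indVec T) j).card := by positivity
  rw [div_le_div_iff₀ hA hB]
  exact mul_le_mul_of_nonneg_left (pow_le_pow_right₀ (by norm_num) hcard) (by positivity)

end Summit.QuantumAdvantage.AdviceFreeQNC0.UCoord39
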